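import Literature.NumberTheory.GaloisCohomology.PoitouTateSelmerStructures
import HarnessLib

/-!
# T1 JET (cell `bsd-jet`), road K, file 2/3: the element form of Poitou–Tate duality for Selmer
# structures RESTRICTED TO THE FINITE PLACES of `S` (tuples indexed by `T = S ∩ {finite places}`)

HONEST FRAMING (programme file `BSD-LIT2PART-PROGRAMME-v1.md` §HONESTY, verbatim): «no tranche here
proves BSD; ARM L moves the LITERAL column of an r ≤ 1 census into the kernel-proved-modulo-named-print
column; ARM P changes what «named print» is worth.» THEOREMS ONLY (seat `bsd-jet-pv-1`, session g3;
`--supports stmt-BirchSwinnertonDyer-14418`, helper): no definition, no named fact, no `sorry`.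
Nothing is booked; 0 classes move. GENERIC Galois cohomology: no elliptic curve, no `p`-versus-`N`.

## What (inputs of file 3/3 `Theorems/Rank1ResidualJetGlobalDuality.lean`, the COUNTING form
## `[H¹_𝓖 : H¹_𝓕] · [H¹_{𝓕^*} : H¹_{𝓖^*}] = ∏_{v ∈ T} [𝓖_v : 𝓕_v]` of Howard 2004 Thm. 2.1.11 ∕
## Jetchev 2008 Thm. 5.1, which the cell's abstract Thm. 6.3 `JET.Section6.…` consumes as `horth_q`, `horth_ℓ`)

The tree's named fact `poitouTate_selmerStructure_duality K` (`PoitouTateSelmerStructures.lean`) states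
Howard's Thm. 2.1.11 in ELEMENT form with tuples indexed by ALL places of a finite set `S ∋` the
archimedean places. The counting argument runs on the finite products `Π_{v ∈ T} H¹(K_v, M)` over the
FINITE places `T` of `S` (where local Tate duality `IsPerfect` is available), for Selmer structures
`𝓕 ≤ 𝓖` that agree at the infinite places. This file moves the two halves of «exact orthogonal
complements» from `S` to `T`:

* `sum_places_eq_sum_finset` — a sum over `S` whose terms vanish at the infinite places is the sum
  over `T`; `selmerGroup_mono`; `mem_selmerGroup_of_forall_mem` — if `𝓑_v ≤ 𝓐_v` off `T`, a class of
  `H¹_𝓑` with localisations in `𝓐_v` at `v ∈ T` lies in `H¹_𝓐` (the kernel of `H¹_𝓖 → ⊕_{v∈T} 𝓖_v/𝓕_v`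
  is `H¹_𝓕`);
* `sum_localTatePairingZMod_selmer_eq_zero` — **image ⊆ annihilator over `T`**: for `x ∈ H¹_𝓖(K, M)`,
  `y ∈ H¹_{𝓕^*}(K, M^D)`, `∑_{v ∈ T} ⟨loc_v x, loc_v y⟩_v = 0` (the Poitou–Tate vanishing
  `SumLocalTermEqZero`, Milne I Thm. 4.10(b) `Im β¹ ⊆ Ker γ¹`; the terms off `T` vanish one by one);
* `exists_mem_dualSelmerGroup_of_forall_sum_eq_zero` — **annihilator ⊆ image over `T`**: a tuple
  `(u_v)_{v ∈ T}`, `u_v ∈ 𝓕_v^*`, annihilating `(loc_v x)_{v∈T}` for all `x ∈ H¹_𝓖` is `(loc_v y)_v`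
  modulo `(𝓖_v^*)_v` for some `y ∈ H¹_{𝓕^*}` (`SelmerComplement` (ii), extending `u` by zero).

References (locators only; no cited FACT is declared): [cite: Howard2004HeegnerKolyvagin, Thm. 2.1.11
(arXiv:1202.6340 p. 6)] [cite: MilneADT2006, Ch. I, Thm. 4.10(b)] [cite: Jetchev2008, Thm. 5.1 (p. 822)].
Design: no definitions; universe `u` for `K`, `M` as in `PoitouTate.lean`. Axioms: `propext`,
`Classical.choice`, `Quot.sound`.
-/

set_option autoImplicit false

noncomputable section

open scoped Classical
open Function NumberField IsDedekindDomain
open Literature.NumberTheory.GaloisRepresentations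

universe u

namespace Summit.BirchSwinnertonDyer.Rank1Residual.JET.GlobalDuality

/-! ### Poitou–Tate for Selmer structures, element form over the finite places of `S` -/

section Galois

open Literature.NumberTheory.GaloisCohomology
open Literature.NumberTheory.GaloisRepresentations.DiscreteGaloisModule (localTatePairingZMod
  tateDual SelmerStructure)

variable {K : Type u} [Field K] [NumberField K]

omit [NumberField K] in
/-- A sum over a finite set `S` of places whose terms vanish at the infinite places is the sum over
the finite places of `S`, indexed by `T = {v finite : v ∈ S}`. -/
theorem sum_places_eq_sum_finset {β : Type*} [AddCommMonoid β] (S : Finset (Place K))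
    (T : Finset (HeightOneSpectrum (𝓞 K))) (hT : ∀ v, (Sum.inr v : Place K) ∈ S ↔ v ∈ T)
    (f : Place K → β) (hf : ∀ w : InfinitePlace K, f (Sum.inl w) = 0) :
    ∑ v ∈ S, f v = ∑ v ∈ T, f (Sum.inr v) := by
  have hmap : ∑ v ∈ T.map ⟨Sum.inr, Sum.inr_injective⟩, f v = ∑ v ∈ T, f (Sum.inr v) := by
    rw [Finset.sum_map]; rfl
  rw [← hmap]
  refine (Finset.sum_subset ?_ ?_).symm
  · intro v hv
    rw [Finset.mem_map] at hv
    obtain ⟨v', hv', rfl⟩ := hv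
    exact (hT v').mpr hv'
  · intro v hv hv'
    cases v with
    | inl w => exact hf w
    | inr v' =>
      exact absurd (Finset.mem_map_of_mem ⟨Sum.inr, Sum.inr_injective⟩ ((hT v').mp hv)) hv'

variable {n : ℕ} {M : Type u} [AddCommGroup M] [TopologicalSpace M] [DiscreteTopology M]
  {ρ : DiscreteGaloisModule K M}

/-- `𝓕 ≤ 𝓖 ⟹ H¹_𝓕(K, M) ≤ H¹_𝓖(K, M)`. [cite: Howard2004HeegnerKolyvagin, Thm. 2.1.11 (arXiv:1202.6340 p. 6)] -/
theorem selmerGroup_mono {𝓕 𝓖 : SelmerStructure ρ} (h : 𝓕 ≤ 𝓖) :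
    𝓕.selmerGroup ≤ 𝓖.selmerGroup := by
  intro x hx
  rw [SelmerStructure.mem_selmerGroup_iff] at hx ⊢
  exact fun v => h v (hx v)

/-- If two Selmer structures satisfy `𝓑_v ≤ 𝓐_v` at every place other than the finite places of
`T`, a class of `H¹_𝓑(K, M)` whose localisations at the places of `T` satisfy `𝓐` lies in
`H¹_𝓐(K, M)` (the kernel of `H¹_𝓖 → ⊕_{v ∈ T} 𝓖_v/𝓕_v` is `H¹_𝓕`).
[cite: Howard2004HeegnerKolyvagin, Thm. 2.1.11 (arXiv:1202.6340 p. 6)] -/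
theorem mem_selmerGroup_of_forall_mem (𝓐 𝓑 : SelmerStructure ρ)
    (T : Finset (HeightOneSpectrum (𝓞 K)))
    (hout : ∀ v : Place K, (∀ t ∈ T, v ≠ Sum.inr t) → 𝓑 v ≤ 𝓐 v)
    {x : galoisCohomology ρ 1} (hx : x ∈ 𝓑.selmerGroup)
    (hT : ∀ t ∈ T, galoisCohomology.localization ρ (Sum.inr t) 1 x ∈ 𝓐 (Sum.inr t)) :
    x ∈ 𝓐.selmerGroup := by
  rw [SelmerStructure.mem_selmerGroup_iff] at hx ⊢
  intro v
  by_cases h : ∃ t ∈ T, v = Sum.inr t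
  · obtain ⟨t, ht, rfl⟩ := h
    exact hT t ht
  · push Not at h
    exact hout v h (hx v)

variable [Finite M]

/-- **Image ⊆ annihilator, over the finite places of `S`** (Poitou–Tate vanishing, Milne I 4.10(b)
`Im β¹ ⊆ Ker γ¹`): for `𝓕 ≤ 𝓖` unramified outside `S` and equal at the infinite places,
`x ∈ H¹_𝓖(K, M)` and `y ∈ H¹_{𝓕^*}(K, M^D)`, the local Tate pairings of `loc_v x`, `loc_v y` sum to
zero over the finite places `v ∈ S` (the terms at the other places vanish one by one).
[cite: Howard2004HeegnerKolyvagin, Thm. 2.1.11 (arXiv:1202.6340 p. 6)] [cite: MilneADT2006, Ch. I, Thm. 4.10(b)] -/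
theorem sum_localTatePairingZMod_selmer_eq_zero {inv : LocalInvariants K n}
    (hvan : inv.SumLocalTermEqZero) (hM : ∀ m : M, n • m = 0)
    (S : Finset (Place K)) (T : Finset (HeightOneSpectrum (𝓞 K)))
    (hT : ∀ v, (Sum.inr v : Place K) ∈ S ↔ v ∈ T)
    {𝓕 𝓖 : SelmerStructure ρ} (h𝓕 : 𝓕.IsUnramifiedOutside S) (h𝓖 : 𝓖.IsUnramifiedOutside S)
    (hinf : ∀ w : InfinitePlace K, 𝓕 (Sum.inl w) = 𝓖 (Sum.inl w))
    {x : galoisCohomology ρ 1} (hx : x ∈ 𝓖.selmerGroup)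
    {y : galoisCohomology (ρ.tateDual n) 1} (hy : y ∈ (inv.dualSelmerStructure ρ 𝓕).selmerGroup) :
    ∑ t ∈ T, localTatePairingZMod ρ n (Sum.inr t) (inv (Sum.inr t))
        (galoisCohomology.localization ρ (Sum.inr t) 1 x)
        (galoisCohomology.localization (ρ.tateDual n) (Sum.inr t) 1 y) = 0 := by
  have hout : ∀ v ∉ S, 𝓖 v ≤ 𝓕 v := fun v hv =>
    le_of_eq (SelmerStructure.IsUnramifiedOutside.apply_eq_of_not_mem h𝓕 h𝓖 hv).symm
  have h := hvan.sum_localTerm_selmer_eq_zero ρ hM hout hx hy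
  have hx' := hx
  have hy' := hy
  rw [SelmerStructure.mem_selmerGroup_iff] at hx' hy'
  rw [sum_places_eq_sum_finset S T hT] at h
  · simpa only [LocalInvariants.localTerm_apply, DiscreteGaloisModule.localTatePairingZMod_apply] using h
  · intro w
    exact inv.localTerm_eq_zero_of_mem_of_mem_dual ρ (Sum.inl w) (𝓕 (Sum.inl w))
      ((hinf w).symm ▸ hx' (Sum.inl w)) (hy' (Sum.inl w))

/-- **Annihilator ⊆ image, over the finite places of `S`** (Howard Thm. 2.1.11, second sequence,
`⊇`; the conjunct `SelmerComplement` (ii) of the tree's Poitou–Tate fact, restated for tuples indexed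
by the finite places `T` of `S`): a tuple `u = (u_v)_{v ∈ T}`, `u_v ∈ 𝓕_v^*`, that annihilates
`(loc_v x)_{v ∈ T}` for every `x ∈ H¹_𝓖(K, M)` is `(loc_v y)_v` modulo `(𝓖_v^*)_v` for some
`y ∈ H¹_{𝓕^*}(K, M^D)`. [cite: Howard2004HeegnerKolyvagin, Thm. 2.1.11 (arXiv:1202.6340 p. 6)] -/
theorem exists_mem_dualSelmerGroup_of_forall_sum_eq_zero {inv : LocalInvariants K n}
    (hSC : inv.SelmerComplement) (hM : ∀ m : M, n • m = 0)
    (S : Finset (Place K)) (T : Finset (HeightOneSpectrum (𝓞 K)))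
    (hT : ∀ v, (Sum.inr v : Place K) ∈ S ↔ v ∈ T)
    (hS : ∀ v : HeightOneSpectrum (𝓞 K), (Sum.inr v : Place K) ∉ S →
      ((n : ℕ) : 𝓞 K) ∉ v.asIdeal ∧ GaloisRep.IsUnramifiedAt v ρ)
    {𝓕 𝓖 : SelmerStructure ρ} (hle : 𝓕 ≤ 𝓖) (h𝓕 : 𝓕.IsUnramifiedOutside S)
    (h𝓖 : 𝓖.IsUnramifiedOutside S)
    (u : ∀ t : T, galoisCohomology ((ρ.tateDual n).toLocal (Sum.inr (t : HeightOneSpectrum (𝓞 K)))) 1)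
    (hu : ∀ t : T, u t ∈ inv.dualSelmerStructure ρ 𝓕 (Sum.inr (t : HeightOneSpectrum (𝓞 K))))
    (hsum : ∀ x ∈ 𝓖.selmerGroup,
      ∑ t : T, localTatePairingZMod ρ n (Sum.inr (t : HeightOneSpectrum (𝓞 K)))
        (inv (Sum.inr (t : HeightOneSpectrum (𝓞 K))))
        (galoisCohomology.localization ρ (Sum.inr (t : HeightOneSpectrum (𝓞 K))) 1 x) (u t) = 0) :
    ∃ y ∈ (inv.dualSelmerStructure ρ 𝓕).selmerGroup, ∀ t : T,
      galoisCohomology.localization (ρ.tateDual n) (Sum.inr (t : HeightOneSpectrum (𝓞 K))) 1 y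
        - u t ∈ inv.dualSelmerStructure ρ 𝓖 (Sum.inr (t : HeightOneSpectrum (𝓞 K))) := by
  -- extend `u` by zero to all places
  let ũ : ∀ v : Place K, galoisCohomology ((ρ.tateDual n).toLocal v) 1 := fun v =>
    match v with
    | Sum.inl _ => 0
    | Sum.inr v => if h : v ∈ T then u ⟨v, h⟩ else 0
  have hũl : ∀ w : InfinitePlace K, ũ (Sum.inl w) = 0 := fun _ => rfl
  have hũr : ∀ t : T, ũ (Sum.inr (t : HeightOneSpectrum (𝓞 K))) = u t := fun t => by
    show (if h : (t : HeightOneSpectrum (𝓞 K)) ∈ T then u ⟨t, h⟩ else 0) = u t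
    rw [dif_pos t.2]
  have hũS : ∀ v ∈ S, ũ v ∈ inv.dualSelmerStructure ρ 𝓕 v := by
    intro v hv
    cases v with
    | inl w => rw [hũl]; exact zero_mem _
    | inr v =>
      have hvT : v ∈ T := (hT v).mp hv
      rw [hũr ⟨v, hvT⟩]
      exact hu ⟨v, hvT⟩
  have hsumS : ∀ x ∈ 𝓖.selmerGroup,
      ∑ v ∈ S, localTatePairingZMod ρ n v (inv v) (galoisCohomology.localization ρ v 1 x) (ũ v)
        = 0 := by
    intro x hx
    rw [sum_places_eq_sum_finset S T hT _ (fun w => by rw [hũl, map_zero]), ← Finset.sum_coe_sort]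
    rw [← hsum x hx]
    exact Finset.sum_congr rfl fun t _ => by rw [hũr]
  obtain ⟨y, hy, hyu⟩ := (hSC ρ hM S hS 𝓕 𝓖 hle h𝓕 h𝓖).2 ũ hũS hsumS
  refine ⟨y, hy, fun t => ?_⟩
  have := hyu (Sum.inr (t : HeightOneSpectrum (𝓞 K))) ((hT _).mpr t.2)
  rwa [hũr] at this

end Galois

end Summit.BirchSwinnertonDyer.Rank1Residual.JET.GlobalDuality

end
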